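import Literature.Analysis.FluidPDE.SolenoidalTruncation
import HarnessLib

/-!
# The solenoidal truncation with a general cut-off
  (tools for item stmt-NavierStokesRegularity-2928, `RobustBlowupPortability.DivFreeTruncation`)

The tree's `Literature.Analysis.FluidPDE.solenoidalTruncation V R` corrects the cut-off `χ_R V` of a
divergence-free field `V` (dimension `3`) by the Poincaré homotopy field `F = poincareField V`
(`F(x) = ∫₀¹ t V(t x) dt`): `Ψ = χ V + Dχ(x)[x] F − Dχ(x)[F] x` is divergence free
(`isDivFree_solenoidalTruncation`). That file fixes the dyadic cut-off `χ_R = cutoff R` (`= 1` on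
`‖x‖ ≤ R`, `= 0` off `‖x‖ ≤ 2R`). For the divergence-free truncation WITH COLLAR CONTROL (item 2928)
the construction is averaged over the centre of the homotopy, which needs room between the two radii,
hence a cut-off with an arbitrary profile. This file re-runs the (purely pointwise) computation for an
arbitrary `C²` (resp. `C^∞`) scalar cut-off `χ`:

* `hasFDerivAt_cutoffTruncation`, `contDiff_cutoffTruncation` — Leibniz rules / smoothness;
* `isDivFree_cutoffTruncation` — `div Ψ = 0` when `div W = 0` (radial identity
  `DF(x)x + 2F(x) = W(x)`, `div F = 0`, symmetry of `D²χ`), verbatim the tree argument;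
* `cutoffTruncation_eq_self`, `cutoffTruncation_eq_zero` — `Ψ = W` where `χ = 1`, `Dχ = 0`, and
  `Ψ = 0` where `χ = 0`, `Dχ = 0`.

The truncation is written out explicitly in every statement (as a hypothesis `hΨ : Ψ = fun y => …`),
so that no new definition is introduced.

HONEST FRAMING: pointwise vector calculus; nothing here bears on Navier–Stokes regularity.

## References
* G. P. Galdi, *An Introduction to the Mathematical Theory of the Navier–Stokes Equations*, 2nd ed.
  (2011), §III.3 (Bogovskiĭ's problem), Thm. III.4.3.
-/

noncomputable section

set_option linter.dupNamespace false

namespace Summit.NavierStokesRegularity.NavierStokesRegularity.Theorems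

open Set Filter Topology Function ContinuousLinearMap Module
open scoped ContDiff
open Literature.Analysis.FluidPDE

namespace DivFreeTruncation

variable {E : Type*} [NormedAddCommGroup E] [InnerProductSpace ℝ E] [FiniteDimensional ℝ E]
variable {χ : E → ℝ} {W : E → E} {Ψ : E → E}

/-- **Leibniz rule for the truncation with a general cut-off**: the derivative of
`Ψ(y) = χ(y) W(y) + Dχ(y)[y] F(y) − Dχ(y)[F(y)] y`, `F = poincareField W`, for `χ ∈ C²`,
`W ∈ C¹` (verbatim the tree's `hasFDerivAt_solenoidalTruncation`). [folklore] -/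
theorem hasFDerivAt_cutoffTruncation (hχ : ContDiff ℝ 2 χ) (hW : ContDiff ℝ 1 W)
    (hΨ : Ψ = fun y => χ y • W y + (fderiv ℝ χ y y) • poincareField W y -
      (fderiv ℝ χ y (poincareField W y)) • y) (x : E) :
    HasFDerivAt Ψ
      (χ x • fderiv ℝ W x + (fderiv ℝ χ x).smulRight (W x) +
        ((fderiv ℝ χ x x) • fderiv ℝ (poincareField W) x +
          ((fderiv ℝ χ x).comp (ContinuousLinearMap.id ℝ E) +
            (fderiv ℝ (fderiv ℝ χ) x).flip x).smulRight (poincareField W x)) -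
        ((fderiv ℝ χ x (poincareField W x)) • ContinuousLinearMap.id ℝ E +
          ((fderiv ℝ χ x).comp (fderiv ℝ (poincareField W) x) +
            (fderiv ℝ (fderiv ℝ χ) x).flip (poincareField W x)).smulRight x)) x := by
  subst hΨ
  have hχ1 : HasFDerivAt χ (fderiv ℝ χ x) x :=
    ((hχ.of_le (by norm_num)).differentiable one_ne_zero x).hasFDerivAt
  have hDχ : HasFDerivAt (fderiv ℝ χ) (fderiv ℝ (fderiv ℝ χ) x) x :=
    ((hχ.fderiv_right (m := 1) le_rfl).differentiable one_ne_zero x).hasFDerivAt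
  have hWx : HasFDerivAt W (fderiv ℝ W x) x := (hW.differentiable one_ne_zero x).hasFDerivAt
  have hF : HasFDerivAt (poincareField W) (fderiv ℝ (poincareField W) x) x :=
    hasFDerivAt_poincareField hW x |>.differentiableAt.hasFDerivAt
  have h1 := hχ1.smul hWx
  have ha := hDχ.clm_apply (hasFDerivAt_id x)
  have h2 := ha.smul hF
  have hb := hDχ.clm_apply hF
  have h3 := hb.smul (hasFDerivAt_id x)
  exact (h1.add h2).sub h3

/-- The truncation with a smooth cut-off of a smooth field is smooth. [folklore] -/
theorem contDiff_cutoffTruncation (hχ : ContDiff ℝ ∞ χ) (hW : ContDiff ℝ ∞ W)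
    (hΨ : Ψ = fun y => χ y • W y + (fderiv ℝ χ y y) • poincareField W y -
      (fderiv ℝ χ y (poincareField W y)) • y) :
    ContDiff ℝ ∞ Ψ := by
  subst hΨ
  have hDχ : ContDiff ℝ ∞ (fderiv ℝ χ) := hχ.fderiv_right (by exact_mod_cast le_top)
  have hF : ContDiff ℝ ∞ (poincareField W) := contDiff_poincareField hW
  exact ((hχ.smul hW).add ((hDχ.clm_apply contDiff_id).smul hF)).sub
    ((hDχ.clm_apply hF).smul contDiff_id)

omit [FiniteDimensional ℝ E] in
/-- The Hessian of a `C²` scalar function is symmetric. [folklore] -/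
theorem fderiv_fderiv_symm_of_contDiff (hχ : ContDiff ℝ 2 χ) (x v w : E) :
    fderiv ℝ (fderiv ℝ χ) x v w = fderiv ℝ (fderiv ℝ χ) x w v :=
  (hχ.contDiffAt (x := x)).isSymmSndFDerivAt
    (by simp [minSmoothness_of_isRCLikeNormedField]) v w

/-- **The truncation with a general cut-off of a divergence-free field is divergence free**
(dimension `3`): `div(χW) = Dχ(W)`, `div(Dχ(x)F) = Dχ(F) + D²χ(F, x)`,
`div(Dχ(F)x) = 3Dχ(F) + Dχ(DF x) + D²χ(x, F)`, and
`Dχ(W) + Dχ(F) − 3Dχ(F) − Dχ(DF x) = Dχ(W − 2F − DF x) = 0` by the radial identity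
`fderiv_poincareField_apply_self_add`, the Hessian being symmetric and `div W = div F = 0`
(verbatim the tree's `isDivFree_solenoidalTruncation`). [folklore] -/
theorem isDivFree_cutoffTruncation (hE : finrank ℝ E = 3) (hχ : ContDiff ℝ 2 χ)
    (hW : ContDiff ℝ 1 W) (hdiv : VectorCalculus.IsDivFree W)
    (hΨ : Ψ = fun y => χ y • W y + (fderiv ℝ χ y y) • poincareField W y -
      (fderiv ℝ χ y (poincareField W y)) • y) :
    VectorCalculus.IsDivFree Ψ := by
  intro x
  rw [divergence_eq_traceCLM, (hasFDerivAt_cutoffTruncation hχ hW hΨ x).fderiv]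
  have hV0 : traceCLM (fderiv ℝ W x) = 0 := by rw [← divergence_eq_traceCLM]; exact hdiv x
  have hF0 : traceCLM (fderiv ℝ (poincareField W) x) = 0 := by
    rw [← divergence_eq_traceCLM]; exact divergence_poincareField hW hdiv x
  have hrad := fderiv_poincareField_apply_self_add hW x
  have hsymm := fderiv_fderiv_symm_of_contDiff hχ x (poincareField W x) x
  simp only [map_add, map_sub, map_smul, traceCLM_smulRight, traceCLM_id, hV0, hF0, hE,
    _root_.add_apply, ContinuousLinearMap.comp_apply,
    ContinuousLinearMap.id_apply, ContinuousLinearMap.flip_apply, smul_eq_mul]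
  rw [← hrad, hsymm]
  simp only [map_add, map_smul, smul_eq_mul]
  push_cast
  ring

omit [FiniteDimensional ℝ E] in
/-- Where the cut-off equals `1` with vanishing derivative, the truncation is the field itself.
[folklore] -/
theorem cutoffTruncation_eq_self
    (hΨ : Ψ = fun y => χ y • W y + (fderiv ℝ χ y y) • poincareField W y -
      (fderiv ℝ χ y (poincareField W y)) • y) {x : E} (h1 : χ x = 1) (h2 : fderiv ℝ χ x = 0) :
    Ψ x = W x := by
  subst hΨ
  simp [h1, h2]

omit [FiniteDimensional ℝ E] in
/-- Where the cut-off vanishes together with its derivative, the truncation vanishes. [folklore] -/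
theorem cutoffTruncation_eq_zero
    (hΨ : Ψ = fun y => χ y • W y + (fderiv ℝ χ y y) • poincareField W y -
      (fderiv ℝ χ y (poincareField W y)) • y) {x : E} (h1 : χ x = 0) (h2 : fderiv ℝ χ x = 0) :
    Ψ x = 0 := by
  subst hΨ
  simp [h1, h2]

omit [FiniteDimensional ℝ E] in
/-- If the cut-off is locally constant near `x` (eventually equal to the constant `c`), its
derivative vanishes at `x`. [folklore] -/
theorem fderiv_eq_zero_of_eventuallyEq_const {x : E} {c : ℝ} (h : χ =ᶠ[𝓝 x] fun _ => c) :
    fderiv ℝ χ x = 0 := by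
  rw [h.fderiv_eq]
  exact congrFun (fderiv_const c) x

end DivFreeTruncation

end Summit.NavierStokesRegularity.NavierStokesRegularity.Theorems
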